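import Summits.ResolutionOfSingularities.ResolutionOfSingularities.Theorems.WildConesNarrowRunsDieStubDict

/-!
# Crux `Steer` (stmt-ResolutionOfSingularities-16345), line `switching_dichotomy` r9, Dictionary seam **S**:
# `order_le_of_X_pow_dvd_subst` — the blow-up substitution raises `X_j`-divisibility only as far as the order

OURS (campaign `res-hironaka`, rung L, slot W4.1, chain W4.1; replaces the role of no printed item; NOT a
statement of the manuscript under review). Seam S of lead-1's DICT-SIGS v3
(`HOME/L/res-L0-w41-lead-1/DICT-SIGS.lean`), the helper the leaf of the registered stub
`stub_core4Dictionary` consumes for the multiplicity transfer (CHAIN w41 v4.3): for the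
blow-up-and-translate substitution `Φ_{j,τ} : X_j ↦ X_j, X_s ↦ X_j (X_s + τ_s)` of `κ⟦X_1, …, X_d⟧`,

  `X_j ^ e ∣ Φ_{j,τ}(H) ⇒ e ≤ ord H`

(the converse of `MuDropCharTwoOrdP.X_pow_dvd_subst_blowFam`). Proof by the sibling crux's coefficient
DICTIONARY `NarrowRunsDie.dict_coeff_lhs` (the closed formula for the coefficients of `Φ_{j,τ}(H)`): if
`ord H = m < e`, take among the exponents `A` of degree `m` with `[X^A] H ≠ 0` one with MINIMAL `A_j`; at the
exponent `E = (E_j := m, E_s := A_s)` the only degree-`m` exponent `D` with `D_s ≥ A_s (s ≠ j)` and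
`[X^D] H ≠ 0` is `A` itself, so `[X^E] Φ(H) = [X^A] H ≠ 0`, contradicting `X_j ^ e ∣ Φ(H)` (`E_j = m < e`).
Pure power series; no Theses import. [folklore]
-/

noncomputable section

-- `Summit.<S>.<S>.…` duplicates the summit name by design (single-problem summit).
set_option linter.dupNamespace false

open scoped BigOperators Classical

open MvPowerSeries Finset

namespace Summit.ResolutionOfSingularities.ResolutionOfSingularities.Theorems.SwitchingDichotomy

open Summit.ResolutionOfSingularities.ResolutionOfSingularities.Theorems.NarrowRunsDie (dict_coeff_lhs)

namespace OrderBound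

variable {κ : Type} [Field κ] {d : ℕ}

/-- The `if`-family and the `@ite … (Classical.dec _)`-family of the blow-up substitution agree.
[folklore] -/
theorem blowFam_eq_classical (j : Fin d) (τ : Fin d → κ) :
    (fun s : Fin d => if s = j then (X j : MvPowerSeries (Fin d) κ) else X j * (X s + C (τ s))) =
      fun s : Fin d => @ite (MvPowerSeries (Fin d) κ) (s = j) (Classical.dec _) (MvPowerSeries.X j)
        (MvPowerSeries.X j * (MvPowerSeries.X s + MvPowerSeries.C (τ s))) := by
  funext s
  by_cases hs : s = j
  · rw [if_pos hs, if_pos hs]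
  · rw [if_neg hs, if_neg hs]

end OrderBound

open OrderBound

/-- **Seam S `order_le_of_X_pow_dvd_subst`** (DICT-SIGS v3, statement verbatim): the blow-up-and-translate
substitution `Φ_{j,τ}` (`X_j ↦ X_j`, `X_s ↦ X_j (X_s + τ_s)`) raises `X_j`-divisibility only as far as the
order allows: `X_j ^ e ∣ Φ_{j,τ}(H) ⇒ e ≤ ord H`. [folklore] -/
theorem order_le_of_X_pow_dvd_subst {κ : Type} [Field κ] {d : ℕ} (j : Fin d) (τ : Fin d → κ)
    (H : MvPowerSeries (Fin d) κ) (e : ℕ)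
    (h : X j ^ e ∣ subst (fun s : Fin d => if s = j then (X j : MvPowerSeries (Fin d) κ)
      else X j * (X s + C (τ s))) H) :
    (e : ℕ∞) ≤ H.order := by
  classical
  by_contra hlt
  push Not at hlt
  -- `H ≠ 0`, `m := ord H < e`
  have hH : H ≠ 0 := by
    rintro rfl
    rw [order_zero] at hlt
    exact not_top_lt hlt
  set m := H.order.toNat with hm
  have hordm : (m : ℕ∞) = H.order := ne_zero_iff_order_finite.mp hH
  have hme : m < e := by
    have := hlt
    rw [← hordm] at this
    exact_mod_cast this
  -- a degree-`m` exponent with non-zero coefficient and MINIMAL `j`-entry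
  have hex : ∃ k, ∃ A : Fin d →₀ ℕ, coeff A H ≠ 0 ∧ A.degree = m ∧ A j = k := by
    obtain ⟨A, hA, hdeg⟩ := exists_coeff_ne_zero_and_order hordm
    refine ⟨A j, A, hA, ?_, rfl⟩
    have := hdeg.trans hordm.symm
    exact_mod_cast this
  obtain ⟨A, hA, hAdeg, hAj⟩ := Nat.find_spec hex
  have hmin : ∀ B : Fin d →₀ ℕ, coeff B H ≠ 0 → B.degree = m → Nat.find hex ≤ B j :=
    fun B hB hBd => Nat.find_min' hex ⟨B, hB, hBd, rfl⟩
  -- the test exponent `E = (E_j := m, E_s := A_s)`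
  let E : Fin d →₀ ℕ := Finsupp.equivFunOnFinite.symm (fun s => if s = j then m else A s)
  have hEj : E j = m := by simp [E]
  have hEs : ∀ s, s ≠ j → E s = A s := fun s hs => by simp [E, hs]
  -- its coefficient vanishes by divisibility …
  have hzero : coeff E (subst (fun s : Fin d => if s = j then (X j : MvPowerSeries (Fin d) κ)
      else X j * (X s + C (τ s))) H) = 0 :=
    (X_pow_dvd_iff.mp h) E (by rw [hEj]; exact hme)
  -- … and equals `[X^A] H` by the dictionary
  have hformula := dict_coeff_lhs (fun D => coeff (Finsupp.equivFunOnFinite.symm D) H) j τ E H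
    (fun D => by simp)
  rw [← blowFam_eq_classical] at hformula
  rw [hformula, Finset.sum_eq_single (⇑A : Fin d → ℕ)] at hzero
  · rw [if_pos ⟨by rw [hEj, ← hAdeg, Finsupp.degree_eq_sum], fun s hs => by rw [hEs s hs]⟩] at hzero
    have hprod : ∏ s ∈ univ.erase j, ((((A s).choose (E s) : ℕ) : κ) * τ s ^ (A s - E s)) = 1 := by
      refine Finset.prod_eq_one fun s hs => ?_
      rw [hEs s (ne_of_mem_erase hs), Nat.choose_self, Nat.sub_self, pow_zero, Nat.cast_one, mul_one]
    rw [hprod, mul_one, Finsupp.equivFunOnFinite_symm_coe] at hzero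
    exact hA hzero
  · -- every other exponent of the box contributes zero
    intro D _ hDA
    by_cases hc : (E j = ∑ s, D s ∧ ∀ s ≠ j, E s ≤ D s)
    · rw [if_pos hc]
      by_contra hne
      have hne' : coeff (Finsupp.equivFunOnFinite.symm D) H ≠ 0 := fun h0 => hne (by rw [h0, zero_mul])
      have hBdeg : (Finsupp.equivFunOnFinite.symm D).degree = m := by
        rw [Finsupp.degree_eq_sum, ← hEj, hc.1]
        simp
      have hk : A j ≤ D j := by
        have := hmin _ hne' hBdeg
        rw [hAj]
        simpa using this
      -- `D ≥ A` termwise with the same sum, so `D = A`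
      have hle : ∀ s ∈ (univ : Finset (Fin d)), A s ≤ D s := fun s _ => by
        by_cases hs : s = j
        · rw [hs]; exact hk
        · have := hc.2 s hs; rwa [hEs s hs] at this
      have hsum : ∑ s, A s = ∑ s, D s := by rw [← hc.1, hEj, ← hAdeg, Finsupp.degree_eq_sum]
      have heq := (Finset.sum_eq_sum_iff_of_le hle).mp hsum
      exact hDA (funext fun s => (heq s (mem_univ s)).symm)
    · rw [if_neg hc]
  · -- `A` lies in the box
    intro hA'
    exfalso
    apply hA'
    rw [Fintype.mem_piFinset]
    intro s
    rw [mem_range, Nat.lt_succ_iff, hEj, ← hAdeg]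
    exact Finsupp.le_degree s A

end Summit.ResolutionOfSingularities.ResolutionOfSingularities.Theorems.SwitchingDichotomy

end
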